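import Mathlib.Analysis.SpecialFunctions.Pow.Real
import Mathlib.Analysis.SpecialFunctions.Pow.Asymptotics
import Literature.Computability.FineGrained.Conjectures
import Literature.Computability.Cryptography.WordRAMReads
import Literature.Computability.Cryptography.WordRAMProofs
import HarnessLib

/-!
# Fine-grained conjectures: the deterministic 3SUM conjecture — status, and its provable (sublinear) regime

Companion to `Literature.Computability.FineGrained.Conjectures` (theorems only), for the named
statement `Literature.Computability.FineGrained.ThreeSUMConjectureDet`
(`∀ ε > 0, ¬ threeSUM.InTimeO (n ↦ n^{2-ε})`: no deterministic word-RAM algorithm decides 3SUM on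
`n` integers of `{-n³, …, n³}` in time `O(n^{2-ε})`, for any `ε > 0`).

## Status of `ThreeSUMConjectureDet` (provefact audit): an open conjecture, no discharge

`ThreeSUMConjectureDet` has **no discharge** `ThreeSUMConjectureDet_holds`: it is the deterministic
weakening of the 3SUM conjecture `ThreeSUMConjecture` (the implication is
`threeSUMConjectureDet_of_threeSUMConjecture_holds` in `Conjectures`), printed everywhere as a
*conjecture* and proved nowhere. Sources, as printed:

* V. Vassilevska Williams, *Hardness of easy problems: basing hardness on popular conjectures such
  as the Strong Exponential Time Hypothesis*, IPEC 2015 (LIPIcs 43), §2.1, **Conjecture 1 (No truly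
  subquadratic 3SUM)**: "In the Word RAM model with `O(log n)` bit words, any algorithm requires
  `n^{2-o(1)}` time in expectation to determine whether a set `S ⊂ {-n³, …, n³}` of size `n`
  contains three distinct elements `a, b, c ∈ S` with `a + b = c`." (after Pătraşcu, STOC 2010,
  §1.3, Conjecture 6, and Gajentaan–Overmars, CGTA 5 (1995), who "formed a theory of 3SUM-hard
  problems", loc. cit.). [cite: VassilevskaWilliamsIPEC2015, §2.1 Conjecture 1]
* Loc. cit., §1 (p. 17:2): "Unconditional lower bounds seem very difficult to obtain – it is not
  even known whether SAT can be solved in linear time."; §2.1: "there are no known `O(n^{2-ε})` time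
  (so-called truly subquadratic) algorithms for the general problem for any `ε > 0`, even when
  randomization can be used." [cite: VassilevskaWilliamsIPEC2015, §1 and §2.1]

So neither direction is available: an `O(n^{2-ε})` algorithm would refute a central hypothesis of
the field, and a proof of `ThreeSUMConjectureDet` would in particular be a superlinear
(`n^{2-ε}` for every `ε ≤ 1`, e.g. `n^{1.5}`) unconditional time lower bound for an explicit
polynomial-time problem on the word RAM, of which none is known.

## What *is* provable: the sublinear regime `ε > 1`

The vendored statement quantifies over all `ε > 0`; for `ε > 1` the forbidden running time
`O(n^{2-ε})` is *sublinear*, and there the statement holds by the standard unread-input-cell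
adversary argument (folklore; the read-counting frame lemma is
`Literature.Computability.Cryptography.WordRAM.OutputsWithin.exists_reads`): a `t`-step
oracle-free word-RAM run reads at most `5t` cells, so for `5t + 3 ≤ n` some input word `p ≥ 2` of
the all-ones instance (answer `0`) is never read, and the run — hence the output `[0]` — is the
same on the instance with `-2` planted at position `p` (answer `1`, as `1 + 1 - 2 = 0`), which has
the same length, the same word size (`inputWidth`, both `= Nat.size n`) and entries in
`{-n³, …, n³}`. This gives

* `threeSUM_not_inTimeO_rpow_of_lt_one`: 3SUM has no deterministic `O(n^a)`-time algorithm for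
  any `a < 1`;
* `threeSUMConjectureDet_of_one_lt`: `ThreeSUMConjectureDet` holds at every `ε > 1`;
* `threeSUMConjectureDet_iff_forall_le_one`: `ThreeSUMConjectureDet` is equivalent to its
  restriction to `0 < ε ≤ 1` — the genuinely open content (at `ε = 1`: "3SUM is not solvable in
  linear time", open).

## References

* V. Vassilevska Williams, IPEC 2015 (LIPIcs 43), §1, §2.1 Conjecture 1.
* M. Pătraşcu, *Towards polynomial lower bounds for dynamic problems*, STOC 2010, §1.3 Conj. 6.
* A. Gajentaan, M. H. Overmars, *On a class of `O(n²)` problems in computational geometry*,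
  Comput. Geom. 5 (1995) 165–185 (3SUM-hardness).
-/

namespace Literature.Computability.FineGrained

open Filter Cryptography Cryptography.WordRAM

/-! ## The adversary pair of instances -/

/-- The all-ones list has no three entries summing to `0` (`1 + 1 + 1 ≠ 0`). [folklore] -/
theorem not_hasThreeSum_replicate_one (n : ℕ) : ¬ HasThreeSum (List.replicate n (1 : ℤ)) := by
  rintro ⟨i, j, k, -, -, h⟩
  simp only [List.get_eq_getElem, List.getElem_replicate] at h
  omega

/-- Planting `-2` at a position `p ≥ 2` of the all-ones list creates a 3SUM solution
(positions `0 < 1 < p`, `1 + 1 - 2 = 0`). [folklore] -/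
theorem hasThreeSum_replicate_one_set {n p : ℕ} (hp : 2 ≤ p) (hpn : p < n) :
    HasThreeSum ((List.replicate n (1 : ℤ)).set p (-2)) := by
  have hlen : ((List.replicate n (1 : ℤ)).set p (-2)).length = n := by simp
  refine ⟨⟨0, by omega⟩, ⟨1, by omega⟩, ⟨p, by omega⟩, Fin.mk_lt_mk.2 (by omega),
    Fin.mk_lt_mk.2 (by omega), ?_⟩
  simp only [List.get_eq_getElem]
  rw [List.getElem_set_ne (by omega), List.getElem_set_ne (by omega), List.getElem_set_self,
    List.getElem_replicate, List.getElem_replicate]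
  norm_num

/-- The all-ones list of length `n ≥ 1` has entries in `{-n³, …, n³}`. [folklore] -/
theorem hasBoundedEntries_replicate_one {n : ℕ} (hn : 1 ≤ n) :
    HasBoundedEntries (List.replicate n (1 : ℤ)) ((List.replicate n (1 : ℤ)).length ^ 3) := by
  intro z hz
  rw [List.eq_of_mem_replicate hz, List.length_replicate, abs_one]
  exact_mod_cast Nat.one_le_pow 3 n hn

/-- The planted list of length `n ≥ 2` has entries in `{-n³, …, n³}`. [folklore] -/
theorem hasBoundedEntries_replicate_one_set {n : ℕ} (hn : 2 ≤ n) (p : ℕ) :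
    HasBoundedEntries ((List.replicate n (1 : ℤ)).set p (-2))
      (((List.replicate n (1 : ℤ)).set p (-2)).length ^ 3) := by
  intro z hz
  rw [List.length_set, List.length_replicate]
  have h3 : (2 : ℤ) ≤ ((n ^ 3 : ℕ) : ℤ) := by
    have h := Nat.pow_le_pow_left hn 3
    have h8 : (2 : ℕ) ≤ 2 ^ 3 := by norm_num
    exact_mod_cast h8.trans h
  rcases List.mem_or_eq_of_mem_set hz with hz | rfl
  · rw [List.eq_of_mem_replicate hz, abs_one]
    linarith
  · simpa using h3

/-! ## Word size: both instances are run with the same `w` -/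

/-- `foldr max 1` of a list of naturals bounded by `M ≥ 1` is at most `M` (a private copy of
`Literature.Computability.FineGrained.foldr_max_one_le` of `…CliqueETHPositionGraph`, not imported
here). [folklore] -/
private theorem foldr_max_one_le_bound {l : List ℕ} {M : ℕ} (hM : 1 ≤ M) (h : ∀ a ∈ l, a ≤ M) :
    l.foldr max 1 ≤ M := by
  induction l with
  | nil => simpa using hM
  | cons a l ih =>
    rw [List.foldr_cons]
    exact max_le (h a (by simp)) (ih fun b hb => h b (by simp [hb]))

/-- An input of length `n ≥ 1` whose words are all at most `n` has input width `Nat.size n`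
(so the word size `k * inputWidth` depends on `n` only). [folklore] -/
theorem inputWidth_eq_size_of_forall_le {l : List ℕ} {n : ℕ} (hlen : l.length = n) (h1 : 1 ≤ n)
    (h : ∀ a ∈ l, a ≤ n) : inputWidth l = Nat.size n := by
  subst hlen
  unfold inputWidth
  rw [max_eq_left (foldr_max_one_le_bound h1 h)]

/-! ## The budget is eventually sublinear -/

/-- For `a < 1` the budget `⌊C n^a + C⌋₊` is eventually below `(n - 3) / 5`. [folklore] -/
theorem exists_five_mul_floor_add_three_le (C : ℝ) {a : ℝ} (ha : a < 1) :
    ∃ n : ℕ, 3 ≤ n ∧ 5 * ⌊C * (n : ℝ) ^ a + C⌋₊ + 3 ≤ n := by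
  set C' := max C 0 with hC'
  have hC'0 : 0 ≤ C' := le_max_right _ _
  have hCC' : C ≤ C' := le_max_left _ _
  have hδ : 0 < 1 - a := by linarith
  have h1 : ∀ᶠ n : ℕ in atTop, 10 * C' ≤ (n : ℝ) ^ (1 - a) :=
    ((tendsto_rpow_atTop hδ).comp tendsto_natCast_atTop_atTop).eventually_ge_atTop _
  have h2 : ∀ᶠ n : ℕ in atTop, 10 * C' + 6 ≤ (n : ℝ) :=
    tendsto_natCast_atTop_atTop.eventually_ge_atTop _
  have h3 : ∀ᶠ n : ℕ in atTop, 3 ≤ n := eventually_ge_atTop 3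
  obtain ⟨n, hn1, hn2, hn3⟩ := (h1.and (h2.and h3)).exists
  refine ⟨n, hn3, ?_⟩
  have hn0 : (0 : ℝ) < n := by exact_mod_cast (by omega : 0 < n)
  have hna : (0 : ℝ) ≤ (n : ℝ) ^ a := Real.rpow_nonneg hn0.le a
  have hfloor : (⌊C * (n : ℝ) ^ a + C⌋₊ : ℝ) ≤ C' * (n : ℝ) ^ a + C' := by
    have hle : C * (n : ℝ) ^ a + C ≤ C' * (n : ℝ) ^ a + C' :=
      add_le_add (mul_le_mul_of_nonneg_right hCC' hna) hCC'
    rcases le_or_gt 0 (C * (n : ℝ) ^ a + C) with h0 | h0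
    · exact (Nat.floor_le h0).trans hle
    · rw [Nat.floor_of_nonpos h0.le, Nat.cast_zero]
      positivity
  have hkey : 10 * C' * (n : ℝ) ^ a ≤ n := by
    calc 10 * C' * (n : ℝ) ^ a ≤ (n : ℝ) ^ (1 - a) * (n : ℝ) ^ a :=
          mul_le_mul_of_nonneg_right hn1 hna
      _ = n := by rw [← Real.rpow_add hn0, sub_add_cancel, Real.rpow_one]
  have h : ((5 * ⌊C * (n : ℝ) ^ a + C⌋₊ + 3 : ℕ) : ℝ) ≤ n := by
    push_cast
    nlinarith [hfloor, hkey, hn2, hC'0, hna]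
  exact_mod_cast h

/-! ## The sublinear regime of the deterministic 3SUM conjecture -/

/-- **3SUM has no sublinear-time deterministic algorithm**: for `a < 1` there is no deterministic
word-RAM algorithm deciding 3SUM (`threeSUM`: `n` integers of `{-n³, …, n³}`, `Θ(log n)`-bit words)
in time `O(n^a)`. Unread-input-cell adversary argument: a run of `t = ⌊C n^a + C⌋₊` steps reads at
most `5t ≤ n - 3` cells (`OutputsWithin.exists_reads`), so some input word `p ≥ 2` of the
all-ones instance is unread and the planted instance (`-2` at position `p`: same length, same word
size, opposite answer) receives the same output. [folklore] -/
theorem threeSUM_not_inTimeO_rpow_of_lt_one {a : ℝ} (ha : a < 1) :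
    ¬ threeSUM.InTimeO fun n => (n : ℝ) ^ a := by
  rintro ⟨C, M, k, -, hof, hM⟩
  obtain ⟨n, hn3, hbudget⟩ := exists_five_mul_floor_add_three_le C ha
  -- the all-ones instance `A` and its run
  have hbA := hasBoundedEntries_replicate_one (n := n) (by omega)
  set lA : List ℤ := List.replicate n (1 : ℤ) with hlA
  have hlenA : lA.length = n := by simp [hlA]
  let A : threeSUM.Inst := ⟨lA, hbA⟩
  have hencA : threeSUM.encode A = List.replicate n 2 := by
    show (List.replicate n (1 : ℤ)).map encodeInt = _
    rw [List.map_replicate]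
    rfl
  have hsizeA : threeSUM.size A = n := by simp [A, hlenA]
  obtain ⟨out, hout, hrunA⟩ := hM A
  rw [threeSUM_good_iff] at hout
  have hnoA : ¬ HasThreeSum lA := not_hasThreeSum_replicate_one n
  rw [if_neg hnoA] at hout
  subst hout
  have hrunA' : OutputsWithin M (k * threeSUM.width A) noOracle zeroCoins (threeSUM.encode A) [0]
      ⌊C * (n : ℝ) ^ a + C⌋₊ := by
    simpa only [hsizeA] using hrunA
  obtain ⟨R, hR, hreads⟩ := hrunA'.exists_reads hof
  -- an unread input cell `p + 1 ∈ {3, …, n}`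
  have hcard : R.card < (Finset.Icc 3 n).card := by
    rw [Nat.card_Icc]
    omega
  obtain ⟨u, hu, huR⟩ := Finset.exists_mem_notMem_of_card_lt_card hcard
  rw [Finset.mem_Icc] at hu
  obtain ⟨p, rfl⟩ : ∃ p, u = p + 1 := ⟨u - 1, by omega⟩
  -- the planted instance `B`
  have hbB := hasBoundedEntries_replicate_one_set (n := n) (by omega) p
  set lB : List ℤ := (List.replicate n (1 : ℤ)).set p (-2) with hlB
  have hlenB : lB.length = n := by simp [hlB]
  let B : threeSUM.Inst := ⟨lB, hbB⟩
  have hencB : threeSUM.encode B = (List.replicate n 2).set p 3 := by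
    show ((List.replicate n (1 : ℤ)).set p (-2)).map encodeInt = _
    rw [List.map_set, List.map_replicate]
    rfl
  -- both runs use the same word size
  have hwA : threeSUM.width A = Nat.size n := by
    show inputWidth (threeSUM.encode A) = _
    rw [hencA]
    refine inputWidth_eq_size_of_forall_le List.length_replicate (by omega) fun b hb => ?_
    rw [List.eq_of_mem_replicate hb]
    omega
  have hwB : threeSUM.width B = Nat.size n := by
    show inputWidth (threeSUM.encode B) = _
    rw [hencB]
    refine inputWidth_eq_size_of_forall_le (by simp) (by omega) fun b hb => ?_
    rcases List.mem_or_eq_of_mem_set hb with hb | rfl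
    · rw [List.eq_of_mem_replicate hb]
      omega
    · omega
  -- the run on `B` with `A`'s reads: output `[0]`
  have hrunB0 : OutputsWithin M (k * threeSUM.width A) noOracle zeroCoins (threeSUM.encode B) [0]
      ⌊C * (n : ℝ) ^ a + C⌋₊ := by
    refine hreads (threeSUM.encode B) (by rw [hencA, hencB]; simp) fun i hi => ?_
    rw [hencA, hencB] at hi
    have hip : i = p := by
      by_contra hip
      exact hi (List.getElem?_set_ne (Ne.symm hip))
    subst hip
    exact ⟨huR, by simp; omega⟩
  -- but `B` is a yes-instance: the correct output is `[1]`
  obtain ⟨outB, houtB, hrunB⟩ := hM B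
  rw [threeSUM_good_iff] at houtB
  have hyesB : HasThreeSum lB := hasThreeSum_replicate_one_set (by omega) (by omega)
  rw [if_pos hyesB] at houtB
  subst houtB
  rw [hwB, ← hwA] at hrunB
  have h01 := outputsWithin_unique_holds hrunB0 hrunB
  simp at h01

/-- **The deterministic 3SUM conjecture holds in the sublinear regime `ε > 1`**: there is no
deterministic `O(n^{2-ε})`-time word-RAM algorithm for 3SUM when `2 - ε < 1` (an algorithm must read
a constant fraction of its input). The regime `0 < ε ≤ 1` is the open conjecture
(`threeSUMConjectureDet_iff_forall_le_one`). [folklore] -/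
theorem threeSUMConjectureDet_of_one_lt (ε : ℝ) (hε : 1 < ε) :
    ¬ threeSUM.InTimeO fun n => (n : ℝ) ^ (2 - ε) :=
  threeSUM_not_inTimeO_rpow_of_lt_one (by linarith)

/-- **The open content of `ThreeSUMConjectureDet` is exactly the regime `0 < ε ≤ 1`**: the
deterministic 3SUM conjecture (Gajentaan–Overmars 1995; VVW IPEC 2015, §2.1, Conjecture 1, in its
deterministic, "no `O(n^{2-ε})` for any `ε > 0`" form) is equivalent to its restriction to
`ε ≤ 1`, the cases `ε > 1` being theorems (`threeSUMConjectureDet_of_one_lt`). At `ε = 1` it reads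
"3SUM has no linear-time algorithm", which is open (VVW IPEC 2015, §1: "it is not even known
whether SAT can be solved in linear time"). [cite: VassilevskaWilliamsIPEC2015, §2.1 Conjecture 1] -/
theorem threeSUMConjectureDet_iff_forall_le_one :
    ThreeSUMConjectureDet ↔
      ∀ ε : ℝ, 0 < ε → ε ≤ 1 → ¬ threeSUM.InTimeO fun n => (n : ℝ) ^ (2 - ε) := by
  refine ⟨fun h ε hε _ => h ε hε, fun h ε hε => ?_⟩
  rcases le_or_gt ε 1 with h1 | h1
  · exact h ε hε h1
  · exact threeSUMConjectureDet_of_one_lt ε h1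

end Literature.Computability.FineGrained
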